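import Mathlib
import HarnessLib

/-!
# `NoHeavyLowerTail` (stmt-CriticalPhenomena-4575) — pattern sums over a DISJOINT UNION of class families (algebra)

Support file (prover `prim-gen-swap` gen 9; `--supports stmt-CriticalPhenomena-4575`).  No definitions, no named facts, no sorries; Mathlib only.

The mixed certificate of seat memo MWF-CERT.md (§3–§4) indexes the classes of a two-port star multigraph by a sum type: forest classes
`α` and chord classes `β`.  A link pattern is then a finset `S ⊆ α ⊕ β`, i.e. a pair (forest pattern `T`, chord pattern `U`) with
`S = T.disjSum U`, and the independent pattern weight factorises.  This file records the resulting double-sum decomposition: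

* `StarSet.sdiff_disjSum` — `univ \ T.disjSum U = (univ \ T).disjSum (univ \ U)`;
* `StarSet.patternWeight_disjSum` — `W_Θ(T.disjSum U) = W_{Θ∘inl}(T) · W_{Θ∘inr}(U)`;
* `StarSet.patternSum_sum_type` — `Σ_S W_Θ(S) f(S) = Σ_U W_{Θ∘inr}(U) Σ_T W_{Θ∘inl}(T) f(T.disjSum U)`.
-/

namespace Summit.CriticalPhenomena.PercolationContinuityZ3.Theorems

open Finset
open scoped BigOperators

namespace StarSet

variable {α β : Type*} [Fintype α] [Fintype β] [DecidableEq α] [DecidableEq β]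

/-- Complement of a disjoint sum of finsets. [folklore] -/
theorem sdiff_disjSum (T : Finset α) (U : Finset β) :
    (univ : Finset (α ⊕ β)) \ T.disjSum U = (univ \ T).disjSum (univ \ U) := by
  ext x
  cases x with
  | inl a => simp [Finset.mem_sdiff, Finset.inl_mem_disjSum]
  | inr b => simp [Finset.mem_sdiff, Finset.inr_mem_disjSum]

/-- The independent pattern weight factorises over a disjoint sum. [folklore] -/
theorem patternWeight_disjSum (Θ : α ⊕ β → ℝ) (T : Finset α) (U : Finset β) :
    (∏ x ∈ T.disjSum U, Θ x) * ∏ x ∈ (univ : Finset (α ⊕ β)) \ T.disjSum U, (1 - Θ x) =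
      (((∏ a ∈ T, Θ (Sum.inl a)) * ∏ a ∈ univ \ T, (1 - Θ (Sum.inl a))) *
        ((∏ b ∈ U, Θ (Sum.inr b)) * ∏ b ∈ univ \ U, (1 - Θ (Sum.inr b)))) := by
  rw [sdiff_disjSum, Finset.prod_disjSum, Finset.prod_disjSum]
  ring

/-- **Pattern sums over a disjoint union of class families.**  See the file header. [folklore] -/
theorem patternSum_sum_type (Θ : α ⊕ β → ℝ) (f : Finset (α ⊕ β) → ℝ) :
    ∑ S ∈ (univ : Finset (α ⊕ β)).powerset, ((∏ x ∈ S, Θ x) * ∏ x ∈ univ \ S, (1 - Θ x)) * f S =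
      ∑ U ∈ (univ : Finset β).powerset, ((∏ b ∈ U, Θ (Sum.inr b)) * ∏ b ∈ univ \ U, (1 - Θ (Sum.inr b))) *
        ∑ T ∈ (univ : Finset α).powerset, ((∏ a ∈ T, Θ (Sum.inl a)) * ∏ a ∈ univ \ T, (1 - Θ (Sum.inl a))) *
          f (T.disjSum U) := by
  classical
  set g : Finset (α ⊕ β) → ℝ := fun S => ((∏ x ∈ S, Θ x) * ∏ x ∈ univ \ S, (1 - Θ x)) * f S with hg
  have h1 : ∑ S ∈ (univ : Finset (α ⊕ β)).powerset, g S = ∑ S : Finset (α ⊕ β), g S := by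
    rw [Finset.powerset_univ]
  have h2 : ∑ S : Finset (α ⊕ β), g S = ∑ p : Finset α × Finset β, g (p.1.disjSum p.2) := by
    refine (Fintype.sum_equiv Finset.sumEquiv.toEquiv.symm (fun p => g (p.1.disjSum p.2)) g fun p => ?_).symm
    simp [Finset.sumEquiv]
  have h3 : ∑ p : Finset α × Finset β, g (p.1.disjSum p.2) = ∑ U : Finset β, ∑ T : Finset α, g (T.disjSum U) := by
    rw [Fintype.sum_prod_type, Finset.sum_comm]
  change ∑ S ∈ (univ : Finset (α ⊕ β)).powerset, g S = _
  rw [h1, h2, h3, ← Finset.powerset_univ]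
  refine Finset.sum_congr rfl fun U _ => ?_
  rw [← Finset.powerset_univ, Finset.mul_sum]
  refine Finset.sum_congr rfl fun T _ => ?_
  simp only [hg]
  rw [patternWeight_disjSum]
  ring

end StarSet

end Summit.CriticalPhenomena.PercolationContinuityZ3.Theorems
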